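import Literature.NumberTheory.EllipticCurves.TateCurve.TateFormalAdditionIdentity
import Literature.NumberTheory.EllipticCurves.TateCurve.TatePointHom
import Literature.NumberTheory.EllipticCurves.TateCurve.UniformizationFormalGroup
import Literature.NumberTheory.EllipticCurves.TateCurve.UniformizationUnitEstimates
import Literature.NumberTheory.EllipticCurves.TateCurve.UniformizationSurjective
import Literature.NumberTheory.EllipticCurves.TateCurve.UniformizationResidueUnits
import Literature.NumberTheory.EllipticCurves.VariableChangePoints
import Literature.NumberTheory.EllipticCurves.PAdicHeightsProofs
import HarnessLib

/-!
# One-unit Tate parameters: tangency estimates and coordinates, over any complete ultrametric field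
# (Silverman ATAEC §V.4, proof of Thm. V.3.1 (c); proofs only)

Topic `Literature/NumberTheory/EllipticCurves/TateCurve`, namespace
`Literature.NumberTheory.EllipticCurves.TateCurve` (cell `bsd-eis`, seat `bsd-eis-k5-c4` g3). These are
the field-generic forms (any complete nontrivially normed ultrametric field `K` of characteristic `0`)
of the `ℚ_p`-lemmas of `SteinWuthrich2013/SplitLogUniformizationProofs.lean` and
`SteinWuthrich2013/SplitUniformizationDataProofs.lean`, needed for the Tate uniformisation over
`ℂ_p` at a NON-split multiplicative prime (discharge of `SteinWuthrich2013.exists_isMultCanonical`):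

* `norm_tateX_one_add_sub_le` — `‖X(1+t,q) − (1+t)/t²‖ ≤ ‖q‖` (`‖t‖ < 1`);
* `norm_tateParam_one_add_sub_le` — `z = −X/Y` at `u = 1+t` has `‖z − t‖ ≤ ‖t‖²`, `‖z‖ = ‖t‖`;
* `norm_param_ofXY_sub_le` — an integral change of variables is tangent to `z ↦ u⁻¹z` on `E₁`;
* `tate_some_add_some`, `tate_some_add_some_eq_zero`, `tate_coords_add`, `tate_coords_neg`,
  `oneUnit_eq_of_tate_eq` — Tate's `φ` is a homomorphism, read on coordinates, and is injective
  on one-units;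
* `norm_mul_sub_one_lt'`, `one_lt_norm_tateX_one_add`,
  `one_lt_norm_toX'` — small facts.

## References
* [SilvermanATAEC1994] J. H. Silverman, *Advanced Topics in the Arithmetic of Elliptic Curves*,
  GTM 151, Springer 1994, Thm. V.3.1 (c) and §V.4 (PDF pp. 395–402).
* [SilvermanAEC2009] J. H. Silverman, *The Arithmetic of Elliptic Curves*, III.1 Table 3.1.
-/

noncomputable section

open scoped Classical

open WeierstrassCurve Literature.NumberTheory.EllipticCurves

namespace Literature.NumberTheory.EllipticCurves.TateCurve

open SteinWuthrich2013

universe u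

variable {K : Type u} [NontriviallyNormedField K] [CompleteSpace K] [IsUltrametricDist K] [CharZero K]

/-- **`X(1+t,q) = (1+t)/t² + O(q)`** on the unit circle off `1`: `‖X(1+t,q) − (1+t)/t²‖ ≤ ‖q‖` for
`‖t‖ < 1` (so `‖1+t‖ = 1`; the principal part `u/(1−u)²` at `u = 1+t`; the remaining terms of
ATAEC p. 396 have norm `≤ ‖q‖`, tree `UniformizationUnitEstimates`).
[cite: SilvermanATAEC1994, §V.4 (PDF p. 401)] -/
theorem norm_tateX_one_add_sub_le {q t : K} (hq : ‖q‖ < 1) (ht : ‖t‖ < 1) :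
    ‖tateX q (1 + t) - (1 + t) / t ^ 2‖ ≤ ‖q‖ := by
  have hu : ‖(1 : K) + t‖ = 1 := by
    have := IsUltrametricDist.norm_add_eq_max_of_norm_ne_norm (x := (1 : K)) (y := t)
      (by rw [norm_one]; exact ht.ne')
    rw [this, norm_one, max_eq_left ht.le]
  have hui : ‖((1 : K) + t)⁻¹‖ = 1 := by rw [norm_inv, hu, inv_one]
  have hpr : (1 + t) / (1 - (1 + t)) ^ 2 = (1 + t) / t ^ 2 := by ring
  rw [← hpr, tateX_sub_principal_eq hq (1 + t)]
  have hA : ‖∑' n : ℕ+, tateXTerm q (1 + t) n‖ ≤ ‖q‖ :=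
    IsUltrametricDist.norm_tsum_le_of_forall_le_of_nonneg (norm_nonneg q)
      fun n => norm_tateXTerm_pnat_le hq hu n
  have hB : ‖∑' n : ℕ+, tateXTerm q (1 + t)⁻¹ n‖ ≤ ‖q‖ :=
    IsUltrametricDist.norm_tsum_le_of_forall_le_of_nonneg (norm_nonneg q)
      fun n => norm_tateXTerm_pnat_le hq hui n
  have hC : ‖2 * tateS 1 q‖ ≤ ‖q‖ := by
    rw [norm_mul]
    calc ‖(2 : K)‖ * ‖tateS 1 q‖ ≤ 1 * ‖q‖ := by
          gcongr
          · exact_mod_cast IsUltrametricDist.norm_natCast_le_one K 2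
          · exact norm_tateS_le hq.le
      _ = ‖q‖ := one_mul _
  have hAB : ‖(∑' n : ℕ+, tateXTerm q (1 + t) n) + ∑' n : ℕ+, tateXTerm q (1 + t)⁻¹ n‖ ≤ ‖q‖ :=
    (IsUltrametricDist.norm_add_le_max _ _).trans (max_le hA hB)
  have h := IsUltrametricDist.norm_add_le_max
    ((∑' n : ℕ+, tateXTerm q (1 + t) n) + ∑' n : ℕ+, tateXTerm q (1 + t)⁻¹ n) (-(2 * tateS 1 q))
  rw [norm_neg, ← sub_eq_add_neg] at h
  exact h.trans (max_le hAB hC)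

/-- **The Tate parameter is tangent to the formal parameter: `z(φ(1+t)) = t + O(t²)`.** For
`0 < ‖t‖ < 1` (and `‖q‖ < 1`), the point `φ(1+t) = (X(1+t,q), Y(1+t,q))` of `E_{q,1}` has
`z = −X/Y` with `‖z − t‖ ≤ ‖t‖²` and `‖z‖ = ‖t‖`: from `X = (1+t)/t² + O(q)`,
`Y = −(1+t)²/t³ + O(q)` one gets `−X/Y = t/(1+t) · (1 + O(qt²))`. (ATAEC §V.4: "`t ↦ −X(1+t,q)/Y(1+t,q)`
… `ψ(t) = t(1 + Σ γ_m t^m)`".) [cite: SilvermanATAEC1994, §V.4 (PDF p. 401)] -/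
theorem norm_tateParam_one_add_sub_le {q t : K} (hq : ‖q‖ < 1) (ht : ‖t‖ < 1) (ht0 : t ≠ 0) :
    ‖-tateX q (1 + t) / tateY q (1 + t) - t‖ ≤ ‖t‖ ^ 2 ∧
      ‖-tateX q (1 + t) / tateY q (1 + t)‖ = ‖t‖ := by
  have htpos : 0 < ‖t‖ := norm_pos_iff.mpr ht0
  have hu : ‖(1 : K) + t‖ = 1 := by
    have := IsUltrametricDist.norm_add_eq_max_of_norm_ne_norm (x := (1 : K)) (y := t)
      (by rw [norm_one]; exact ht.ne')
    rw [this, norm_one, max_eq_left ht.le]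
  have h1t0 : (1 : K) + t ≠ 0 := by
    intro h; rw [h, norm_zero] at hu; exact zero_ne_one hu
  -- the two error terms
  set e₁ := tateX q (1 + t) - (1 + t) / t ^ 2 with he₁
  set e₂ := tateY q (1 + t) + (1 + t) ^ 2 / t ^ 3 with he₂
  have hne₁ : ‖e₁‖ ≤ ‖q‖ := norm_tateX_one_add_sub_le hq ht
  have hne₂ : ‖e₂‖ ≤ ‖q‖ := by
    have h := norm_tateY_sub_principal_le hq hu
    have e : (1 + t) ^ 2 / (1 - (1 + t)) ^ 3 = -((1 + t) ^ 2 / t ^ 3) := by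
      rw [show (1 : K) - (1 + t) = -t by ring, neg_pow, show ((-1 : K) ^ 3) = -1 by norm_num]
      ring
    rw [e, sub_neg_eq_add] at h
    exact h
  have hX : tateX q (1 + t) = ((1 + t) * t + e₁ * t ^ 3) / t ^ 3 := by
    rw [he₁]; field_simp; ring
  have hY : tateY q (1 + t) = (-(1 + t) ^ 2 + e₂ * t ^ 3) / t ^ 3 := by
    rw [he₂]; field_simp; ring
  -- `N := (1+t) t + e₁ t³`, `D := (1+t)² − e₂ t³`, `−X/Y = N/D`
  set N := (1 + t) * t + e₁ * t ^ 3 with hN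
  set D := (1 + t) ^ 2 - e₂ * t ^ 3 with hD
  have ht3 : t ^ 3 ≠ 0 := pow_ne_zero 3 ht0
  have hsmall₁ : ‖e₁ * t ^ 3‖ < ‖(1 + t) * t‖ := by
    rw [norm_mul, norm_mul, hu, one_mul, norm_pow]
    calc ‖e₁‖ * ‖t‖ ^ 3 ≤ 1 * ‖t‖ ^ 3 :=
          mul_le_mul_of_nonneg_right (hne₁.trans hq.le) (pow_nonneg htpos.le 3)
      _ = ‖t‖ * ‖t‖ ^ 2 := by ring
      _ < ‖t‖ * 1 := by
          apply mul_lt_mul_of_pos_left _ htpos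
          calc ‖t‖ ^ 2 < 1 ^ 2 := by gcongr
            _ = 1 := one_pow 2
      _ = ‖t‖ := mul_one _
  have hNn : ‖N‖ = ‖t‖ := by
    rw [hN, IsUltrametricDist.norm_add_eq_max_of_norm_ne_norm hsmall₁.ne', max_eq_left hsmall₁.le,
      norm_mul, hu, one_mul]
  have hsmall₂ : ‖-(e₂ * t ^ 3)‖ < ‖(1 + t) ^ 2‖ := by
    rw [norm_neg, norm_mul, norm_pow, norm_pow, hu, one_pow]
    calc ‖e₂‖ * ‖t‖ ^ 3 ≤ 1 * ‖t‖ ^ 3 :=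
          mul_le_mul_of_nonneg_right (hne₂.trans hq.le) (pow_nonneg htpos.le 3)
      _ < 1 := by rw [one_mul]; exact pow_lt_one₀ htpos.le ht (by norm_num)
  have hDn : ‖D‖ = 1 := by
    rw [hD, sub_eq_add_neg, IsUltrametricDist.norm_add_eq_max_of_norm_ne_norm hsmall₂.ne',
      max_eq_left hsmall₂.le, norm_pow, hu, one_pow]
  have hD0 : D ≠ 0 := by intro h; rw [h, norm_zero] at hDn; exact zero_ne_one hDn
  have hquot : -tateX q (1 + t) / tateY q (1 + t) = N / D := by
    have hY' : tateY q (1 + t) = -D / t ^ 3 := by rw [hY, hD]; ring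
    rw [hX, hY']
    field_simp
  rw [hquot]
  refine ⟨?_, by rw [norm_div, hNn, hDn, div_one]⟩
  -- `N/D − t = (N − tD)/D`, `N − tD = −t²(1+t) + (e₁ + e₂(1+t)… ) t³`-type: norm ≤ ‖t‖²
  have hdiff : N / D - t = (N - t * D) / D := by field_simp
  have hnum : N - t * D = -(1 + t) * t ^ 2 + (e₁ + t * e₂) * t ^ 3 := by
    rw [hN, hD]; ring
  rw [hdiff, norm_div, hDn, div_one, hnum]
  refine (IsUltrametricDist.norm_add_le_max _ _).trans (max_le ?_ ?_)
  · rw [norm_mul, norm_neg, hu, one_mul, norm_pow]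
  · rw [norm_mul, norm_pow]
    have he : ‖e₁ + t * e₂‖ ≤ 1 := by
      refine (IsUltrametricDist.norm_add_le_max _ _).trans (max_le (hne₁.trans hq.le) ?_)
      rw [norm_mul]
      calc ‖t‖ * ‖e₂‖ ≤ 1 * 1 := mul_le_mul ht.le (hne₂.trans hq.le) (norm_nonneg _) zero_le_one
        _ = 1 := mul_one _
    calc ‖e₁ + t * e₂‖ * ‖t‖ ^ 3 ≤ 1 * ‖t‖ ^ 3 :=
          mul_le_mul_of_nonneg_right he (pow_nonneg htpos.le 3)
      _ = ‖t‖ ^ 2 * ‖t‖ := by ring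
      _ ≤ ‖t‖ ^ 2 * 1 := mul_le_mul_of_nonneg_left ht.le (sq_nonneg _)
      _ = ‖t‖ ^ 2 := mul_one _

/-- **The change of variables is tangent to `z ↦ u⁻¹z` on `E₁`.** Let `C = (u,r,s,t)` be
`ℤ_p`-integral with `‖u‖ = 1` and `C • E = E_q` (`‖q‖ < 1`). For a point `(x', y')` of `E_q` with
`‖x'‖ > 1`, the corresponding point `(x, y) = (u²x' + r, u³y' + u²sx' + t)` of `E` satisfies
`‖x‖ = ‖x'‖ > 1`, `y ≠ 0`, and `‖(−x/y) − u⁻¹(−x'/y')‖ ≤ ‖x'/y'‖²` (AEC III.1 Table 3.1: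
`z = u⁻¹z'(1 + O(z'))`; here `‖y'‖² = ‖x'‖³`, ATAEC Lemma V.4.1.1). [Silverman AEC III.1 Table 3.1;
ATAEC §V.4 Lemma 4.1.1] [cite: SilvermanAEC2009, III.1 Table 3.1] -/
theorem norm_param_ofXY_sub_le {E : WeierstrassCurve K} {q : K} (hq : ‖q‖ < 1)
    {C : VariableChange K} (hC : C • E = tateCurve q) (hu : ‖(C.u : K)‖ = 1)
    (hr : ‖C.r‖ ≤ 1) (hs : ‖C.s‖ ≤ 1) (ht : ‖C.t‖ ≤ 1) {x' y' : K}
    (h' : (C • E).toAffine.Nonsingular x' y') (hx' : 1 < ‖x'‖) :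
    1 < ‖C.ofX x'‖ ∧ C.ofY x' y' ≠ 0 ∧
      ‖-C.ofX x' / C.ofY x' y' - (C.u : K)⁻¹ * (-x' / y')‖ ≤ ‖-x' / y'‖ ^ 2 := by
  have heq : y' ^ 2 + x' * y' = x' ^ 3 + tateA4 q * x' + tateA6 q := by
    rw [hC] at h'
    have h1 := h'.1
    rw [WeierstrassCurve.Affine.equation_iff] at h1
    simp only [tateCurve] at h1
    linear_combination h1
  have ha4 : ‖tateA4 q‖ < 1 := (norm_tateA4_le hq.le).trans_lt hq
  have ha6 : ‖tateA6 q‖ < 1 := (norm_tateA6_le hq (by norm_num)).trans_lt hq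
  obtain ⟨hxy, hsq⟩ := norm_lt_norm_y_of_one_lt_norm_x heq ha4 ha6 hx'
  have hx0 : 0 < ‖x'‖ := one_pos.trans hx'
  have hy0' : 0 < ‖y'‖ := hx0.trans hxy
  have hy0 : y' ≠ 0 := norm_pos_iff.mp hy0'
  have hu0 : (C.u : K) ≠ 0 := C.u.ne_zero
  have hyx2 : ‖y'‖ ≤ ‖x'‖ ^ 2 := by
    have : ‖y'‖ ^ 2 ≤ (‖x'‖ ^ 2) ^ 2 := by
      rw [hsq]
      calc ‖x'‖ ^ 3 = ‖x'‖ ^ 2 * ‖x'‖ := by ring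
        _ ≤ ‖x'‖ ^ 2 * ‖x'‖ ^ 2 := by
            apply mul_le_mul_of_nonneg_left _ (sq_nonneg _)
            calc ‖x'‖ = ‖x'‖ ^ 1 := (pow_one _).symm
              _ ≤ ‖x'‖ ^ 2 := pow_le_pow_right₀ hx'.le (by norm_num)
        _ = (‖x'‖ ^ 2) ^ 2 := by ring
    exact (pow_le_pow_iff_left₀ (norm_nonneg _) (sq_nonneg _) two_ne_zero).mp this
  -- `x = u² x' + r` has norm `‖x'‖`
  have hxn : ‖C.ofX x'‖ = ‖x'‖ := by
    have h1 : ‖(C.u : K) ^ 2 * x'‖ = ‖x'‖ := by rw [norm_mul, norm_pow, hu, one_pow, one_mul]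
    have hne : ‖(C.u : K) ^ 2 * x'‖ ≠ ‖C.r‖ := by rw [h1]; exact (hr.trans_lt hx').ne'
    show ‖(C.u : K) ^ 2 * x' + C.r‖ = ‖x'‖
    rw [IsUltrametricDist.norm_add_eq_max_of_norm_ne_norm hne, h1, max_eq_left (hr.trans hx'.le)]
  -- `Yd := u³y' + u²s x' + t` has norm `‖y'‖`
  have hYd : ‖C.ofY x' y'‖ = ‖y'‖ := by
    have h1 : ‖(C.u : K) ^ 3 * y'‖ = ‖y'‖ := by rw [norm_mul, norm_pow, hu, one_pow, one_mul]
    have h2 : ‖(C.u : K) ^ 2 * C.s * x' + C.t‖ < ‖y'‖ := by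
      refine (IsUltrametricDist.norm_add_le_max _ _).trans_lt (max_lt ?_ (ht.trans_lt (hx'.trans hxy)))
      rw [norm_mul, norm_mul, norm_pow, hu, one_pow, one_mul]
      calc ‖C.s‖ * ‖x'‖ ≤ 1 * ‖x'‖ := mul_le_mul_of_nonneg_right hs (norm_nonneg _)
        _ < ‖y'‖ := by rw [one_mul]; exact hxy
    have hne : ‖(C.u : K) ^ 3 * y'‖ ≠ ‖(C.u : K) ^ 2 * C.s * x' + C.t‖ := by
      rw [h1]; exact h2.ne'
    show ‖(C.u : K) ^ 3 * y' + (C.u : K) ^ 2 * C.s * x' + C.t‖ = ‖y'‖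
    rw [add_assoc, IsUltrametricDist.norm_add_eq_max_of_norm_ne_norm hne, h1, max_eq_left h2.le]
  have hYd0 : C.ofY x' y' ≠ 0 := by
    intro h0; rw [h0, norm_zero] at hYd; exact hy0'.ne hYd
  refine ⟨by rw [hxn]; exact hx', hYd0, ?_⟩
  -- the difference over a common denominator
  have key : -C.ofX x' / C.ofY x' y' - (C.u : K)⁻¹ * (-x' / y') =
      (-(C.r * C.u * y') + (C.u : K) ^ 2 * C.s * x' ^ 2 + C.t * x') /
        ((C.u : K) * y' * C.ofY x' y') := by
    have e1 : C.ofX x' = (C.u : K) ^ 2 * x' + C.r := rfl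
    have e2 : C.ofY x' y' = (C.u : K) ^ 3 * y' + (C.u : K) ^ 2 * C.s * x' + C.t := rfl
    set Yd := C.ofY x' y' with hYd_def
    rw [e1, eq_div_iff (mul_ne_zero (mul_ne_zero hu0 hy0) hYd0)]
    field_simp
    rw [e2]
    ring
  rw [key, norm_div, norm_mul, norm_mul, hu, one_mul, hYd]
  have hnum : ‖-(C.r * C.u * y') + (C.u : K) ^ 2 * C.s * x' ^ 2 + C.t * x'‖ ≤ ‖x'‖ ^ 2 := by
    refine (IsUltrametricDist.norm_add_le_max _ _).trans (max_le ?_ ?_)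
    · refine (IsUltrametricDist.norm_add_le_max _ _).trans (max_le ?_ ?_)
      · rw [norm_neg, norm_mul, norm_mul, hu, mul_one]
        calc ‖C.r‖ * ‖y'‖ ≤ 1 * ‖x'‖ ^ 2 := mul_le_mul hr hyx2 (norm_nonneg _) zero_le_one
          _ = ‖x'‖ ^ 2 := one_mul _
      · rw [norm_mul, norm_mul, norm_pow, norm_pow, hu, one_pow, one_mul]
        calc ‖C.s‖ * ‖x'‖ ^ 2 ≤ 1 * ‖x'‖ ^ 2 := mul_le_mul_of_nonneg_right hs (sq_nonneg _)
          _ = ‖x'‖ ^ 2 := one_mul _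
    · rw [norm_mul]
      calc ‖C.t‖ * ‖x'‖ ≤ 1 * ‖x'‖ ^ 2 := by
            refine mul_le_mul ht ?_ (norm_nonneg _) zero_le_one
            calc ‖x'‖ = ‖x'‖ ^ 1 := (pow_one _).symm
              _ ≤ ‖x'‖ ^ 2 := pow_le_pow_right₀ hx'.le (by norm_num)
        _ = ‖x'‖ ^ 2 := one_mul _
  rw [div_le_iff₀ (mul_pos hy0' hy0'), norm_div, norm_neg, div_pow,
    div_mul_eq_mul_div, le_div_iff₀ (pow_pos hy0' 2)]
  calc ‖-(C.r * ↑C.u * y') + ↑C.u ^ 2 * C.s * x' ^ 2 + C.t * x'‖ * ‖y'‖ ^ 2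
      ≤ ‖x'‖ ^ 2 * ‖y'‖ ^ 2 := mul_le_mul_of_nonneg_right hnum (sq_nonneg _)
    _ = ‖x'‖ ^ 2 * (‖y'‖ * ‖y'‖) := by ring

/-! ### Additivity of Tate coordinates on `T = E_q` (as points of any `T` equal to `E_q`) -/

/-- `φ(u) + φ(v) = φ(uv)` on coordinates, for `u, v, uv ∉ q^ℤ`, read on any Weierstrass equation
`T` EQUAL to `E_q`. [cite: SilvermanATAEC1994, Thm. V.3.1 (c) (PDF pp. 397–398)] -/
theorem tate_some_add_some {q : K} (hq0 : q ≠ 0) (hq : ‖q‖ < 1) (T : WeierstrassCurve K)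
    (hT : T = tateCurve q) {u v : Kˣ} (hu : ∀ n : ℤ, (u : K) ≠ q ^ n)
    (hv : ∀ n : ℤ, (v : K) ≠ q ^ n) (huv : ∀ n : ℤ, ((u * v : Kˣ) : K) ≠ q ^ n)
    (h₁ : T.toAffine.Nonsingular (tateX q u) (tateY q u))
    (h₂ : T.toAffine.Nonsingular (tateX q v) (tateY q v))
    (h₃ : T.toAffine.Nonsingular (tateX q (u * v : Kˣ)) (tateY q (u * v : Kˣ))) :
    (.some _ _ h₁ : T.toAffine.Point) + .some _ _ h₂ = .some _ _ h₃ := by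
  subst hT
  have hmul := tatePoint_mul (K := K) addRelX_eq_zero addRelY_eq_zero hq0 hq u v
  rw [tatePoint_of_ne_zpow hq0 hq u hu, tatePoint_of_ne_zpow hq0 hq v hv,
    tatePoint_of_ne_zpow hq0 hq _ huv] at hmul
  exact hmul.symm

/-- `φ(u) + φ(v) = O` on coordinates when `uv ∈ q^ℤ`. [cite: SilvermanATAEC1994, Thm. V.3.1 (c) (PDF pp. 397–398)] -/
theorem tate_some_add_some_eq_zero {q : K} (hq0 : q ≠ 0) (hq : ‖q‖ < 1)
    (T : WeierstrassCurve K) (hT : T = tateCurve q) {u v : Kˣ}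
    (hu : ∀ n : ℤ, (u : K) ≠ q ^ n) (hv : ∀ n : ℤ, (v : K) ≠ q ^ n) {n : ℤ}
    (huv : ((u * v : Kˣ) : K) = q ^ n)
    (h₁ : T.toAffine.Nonsingular (tateX q u) (tateY q u))
    (h₂ : T.toAffine.Nonsingular (tateX q v) (tateY q v)) :
    (.some _ _ h₁ : T.toAffine.Point) + .some _ _ h₂ = 0 := by
  subst hT
  have hmul := tatePoint_mul (K := K) addRelX_eq_zero addRelY_eq_zero hq0 hq u v
  rw [tatePoint_of_ne_zpow hq0 hq u hu, tatePoint_of_ne_zpow hq0 hq v hv,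
    tatePoint_of_eq_zpow (u * v) huv] at hmul
  exact hmul.symm


omit [CompleteSpace K] [CharZero K] in
/-- The one-units form a group: `‖vw − 1‖ < 1`. [folklore] [cite: SilvermanATAEC1994, §V.4 (PDF p. 401)] -/
theorem norm_mul_sub_one_lt' {v w : K} (hv : ‖v - 1‖ < 1) (hw : ‖w - 1‖ < 1) :
    ‖v * w - 1‖ < 1 := by
  have e : v * w - 1 = (v - 1) * w + (w - 1) := by ring
  rw [e]
  refine (IsUltrametricDist.norm_add_le_max _ _).trans_lt (max_lt ?_ hw)
  rw [norm_mul, norm_eq_one_of_norm_sub_one_lt hw, mul_one]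
  exact hv

/-- `‖X(1+t,q)‖ = ‖t‖⁻² > 1` for `0 < ‖t‖ < 1`. [cite: SilvermanATAEC1994, §V.4 (PDF p. 401)] -/
theorem one_lt_norm_tateX_one_add {q t : K} (hq : ‖q‖ < 1) (ht : ‖t‖ < 1) (ht0 : t ≠ 0) :
    1 < ‖tateX q (1 + t)‖ := by
  have htpos : 0 < ‖t‖ := norm_pos_iff.mpr ht0
  have hu : ‖(1 : K) + t‖ = 1 := by
    have := IsUltrametricDist.norm_add_eq_max_of_norm_ne_norm (x := (1 : K)) (y := t)
      (by rw [norm_one]; exact ht.ne')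
    rw [this, norm_one, max_eq_left ht.le]
  have hpr : ‖((1 : K) + t) / t ^ 2‖ = (‖t‖ ^ 2)⁻¹ := by
    rw [norm_div, hu, norm_pow, one_div]
  have hbig : 1 < ‖((1 : K) + t) / t ^ 2‖ := by
    rw [hpr]
    exact one_lt_inv_iff₀.mpr ⟨pow_pos htpos 2, pow_lt_one₀ htpos.le ht two_ne_zero⟩
  have hne : ‖((1 : K) + t) / t ^ 2‖ ≠ ‖tateX q (1 + t) - (1 + t) / t ^ 2‖ :=
    (((norm_tateX_one_add_sub_le hq ht).trans hq.le).trans_lt hbig).ne'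
  have e : tateX q (1 + t) = (1 + t) / t ^ 2 + (tateX q (1 + t) - (1 + t) / t ^ 2) := by ring
  rw [e, IsUltrametricDist.norm_add_eq_max_of_norm_ne_norm hne]
  exact lt_max_of_lt_left hbig


/-- **Coordinates of `φ(u) + φ(v) = φ(uv)`**: if `(X(u),Y(u)) = (x₁,y₁)`, `(X(v),Y(v)) = (x₂,y₂)` on
`T = E_q` and `(x₁,y₁) + (x₂,y₂) = (x₃,y₃)` on `T`, then `uv ∉ q^ℤ` and `(X(uv),Y(uv)) = (x₃,y₃)`
(Tate's `φ` is a homomorphism, tree `TateCurve.tatePoint_mul`).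
[cite: SilvermanATAEC1994, Thm. V.3.1 (c) (PDF pp. 397–398)] -/
theorem tate_coords_add {q : K} (hq0 : q ≠ 0) (hq : ‖q‖ < 1) (T : WeierstrassCurve K)
    (hT : T = tateCurve q) {u v : Kˣ} (hu : ∀ n : ℤ, (u : K) ≠ q ^ n)
    (hv : ∀ n : ℤ, (v : K) ≠ q ^ n) {x₁ y₁ x₂ y₂ x₃ y₃ : K}
    (h₁ : T.toAffine.Nonsingular x₁ y₁) (h₂ : T.toAffine.Nonsingular x₂ y₂)
    (h₃ : T.toAffine.Nonsingular x₃ y₃) (hX₁ : tateX q u = x₁) (hY₁ : tateY q u = y₁)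
    (hX₂ : tateX q v = x₂) (hY₂ : tateY q v = y₂)
    (hS : (.some x₁ y₁ h₁ : T.toAffine.Point) + .some x₂ y₂ h₂ = .some x₃ y₃ h₃) :
    (∀ n : ℤ, ((u * v : Kˣ) : K) ≠ q ^ n) ∧
      tateX q (u * v : Kˣ) = x₃ ∧ tateY q (u * v : Kˣ) = y₃ := by
  subst hT
  have hmul := tatePoint_mul (K := K) addRelX_eq_zero addRelY_eq_zero hq0 hq u v
  have hPu : tatePoint q u = .some x₁ y₁ h₁ := by
    rw [tatePoint_of_ne_zpow hq0 hq u hu]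
    simp only [hX₁, hY₁]
  have hPv : tatePoint q v = .some x₂ y₂ h₂ := by
    rw [tatePoint_of_ne_zpow hq0 hq v hv]
    simp only [hX₂, hY₂]
  rw [hPu, hPv, hS] at hmul
  have huv : ∀ n : ℤ, ((u * v : Kˣ) : K) ≠ q ^ n := by
    intro n hn
    have := tatePoint_of_eq_zpow (q := q) (u * v) hn
    rw [this] at hmul
    exact WeierstrassCurve.Affine.Point.some_ne_zero _ hmul.symm
  refine ⟨huv, ?_, ?_⟩ <;>
  · rw [tatePoint_of_ne_zpow hq0 hq _ huv] at hmul
    simp only [WeierstrassCurve.Affine.Point.some.injEq] at hmul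
    simp only [hmul]

/-- **Coordinates of `φ(u⁻¹) = −φ(u)`**: if `(X(u),Y(u)) = (x,y)` on `T = E_q` then
`(X(u⁻¹),Y(u⁻¹))` are the coordinates of `−(x,y)` on `T` (Silverman ATAEC V.3.1 (c), p. 396; the
tree's `TateCurve.tatePoint_inv`). [cite: SilvermanATAEC1994, Thm. V.3.1 (c) (PDF p. 396)] -/
theorem tate_coords_neg {q : K} (hq0 : q ≠ 0) (hq : ‖q‖ < 1) (T : WeierstrassCurve K)
    (hT : T = tateCurve q) {u : Kˣ} (hu : ∀ n : ℤ, (u : K) ≠ q ^ n) {x y x' y' : K}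
    (h : T.toAffine.Nonsingular x y) (h' : T.toAffine.Nonsingular x' y')
    (hX : tateX q u = x) (hY : tateY q u = y)
    (hN : -(.some x y h : T.toAffine.Point) = .some x' y' h') :
    (∀ n : ℤ, ((u⁻¹ : Kˣ) : K) ≠ q ^ n) ∧
      tateX q (u⁻¹ : Kˣ) = x' ∧ tateY q (u⁻¹ : Kˣ) = y' := by
  subst hT
  have hinv := tatePoint_inv (K := K) hq0 hq u
  have hPu : tatePoint q u = .some x y h := by
    rw [tatePoint_of_ne_zpow hq0 hq u hu]
    simp only [hX, hY]
  rw [hPu, hN] at hinv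
  have hui : ∀ n : ℤ, ((u⁻¹ : Kˣ) : K) ≠ q ^ n := by
    intro n hn
    have := tatePoint_of_eq_zpow (q := q) u⁻¹ hn
    rw [this] at hinv
    exact WeierstrassCurve.Affine.Point.some_ne_zero _ hinv.symm
  refine ⟨hui, ?_, ?_⟩ <;>
  · rw [tatePoint_of_ne_zpow hq0 hq _ hui] at hinv
    simp only [WeierstrassCurve.Affine.Point.some.injEq] at hinv
    simp only [hinv]

/-- **One-units with the same Tate point are equal** (`ker φ = q^ℤ` meets the one-units only in
`1`): if `‖u − 1‖ < 1`, `‖u' − 1‖ < 1` and `(X(u),Y(u)) = (X(u'),Y(u'))` (both off `q^ℤ`), then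
`u = u'`. [Silverman ATAEC Thm. V.3.1 (c) (`ker φ = q^ℤ`), §V.4 (`φ(1+𝔪) = E_{q,1}` injective)]
[cite: SilvermanATAEC1994, Thm. V.3.1 (c) (PDF p. 395)] -/
theorem oneUnit_eq_of_tate_eq {q : K} (hq0 : q ≠ 0) (hq : ‖q‖ < 1) {u u' : Kˣ}
    (hu1 : ‖(u : K) - 1‖ < 1) (hu'1 : ‖(u' : K) - 1‖ < 1)
    (hu : ∀ n : ℤ, (u : K) ≠ q ^ n) (hu' : ∀ n : ℤ, (u' : K) ≠ q ^ n)
    (hX : tateX q u = tateX q u') (hY : tateY q u = tateY q u') : u = u' := by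
  -- `φ(u u'⁻¹) = φ(u) − φ(u') = 0`, so `u u'⁻¹ = qⁿ`; norms force `n = 0`
  have hnorm : ∀ w : Kˣ, ‖(w : K) - 1‖ < 1 → ‖(w : K)‖ = 1 := by
    intro w hw
    have := IsUltrametricDist.norm_add_eq_max_of_norm_ne_norm (x := (w : K) - 1) (y := (1 : K))
      (by rw [norm_one]; exact hw.ne)
    rw [sub_add_cancel, norm_one, max_eq_right hw.le] at this
    exact this
  have hP : tatePoint q u = tatePoint q u' := by
    rw [tatePoint_of_ne_zpow hq0 hq u hu, tatePoint_of_ne_zpow hq0 hq u' hu']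
    simp only [hX, hY]
  have h0 : tatePoint q (u * u'⁻¹) = 0 := by
    rw [tatePoint_mul (K := K) addRelX_eq_zero addRelY_eq_zero hq0 hq, tatePoint_inv hq0 hq,
      hP, add_neg_cancel]
  obtain ⟨n, hn⟩ := (tatePoint_eq_zero_iff hq0 hq _).mp h0
  have hn1 : ‖(q : K) ^ n‖ = 1 := by
    rw [← hn, Units.val_mul, Units.val_inv_eq_inv_val, norm_mul, norm_inv, hnorm u hu1,
      hnorm u' hu'1, inv_one, mul_one]
  have hn0 : n = 0 := by
    rw [norm_zpow] at hn1
    by_contra hne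
    have hqpos : 0 < ‖q‖ := norm_pos_iff.mpr hq0
    rcases lt_or_gt_of_ne hne with hlt | hgt
    · have : 1 < ‖q‖ ^ n := (one_lt_zpow_iff_right_of_lt_one₀ hqpos hq).mpr hlt
      exact absurd hn1 this.ne'
    · have : ‖q‖ ^ n < 1 := (zpow_lt_one_iff_right_of_lt_one₀ hqpos hq).mpr hgt
      exact absurd hn1 this.ne
  rw [hn0, zpow_zero, Units.val_mul, Units.val_inv_eq_inv_val, mul_inv_eq_one₀ u'.ne_zero] at hn
  exact Units.ext hn

/-! ### One-unit Tate parameters of the rational points of `E₁(ℚ_p)` -/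

omit [CompleteSpace K] [CharZero K] in
/-- For `‖r‖ ≤ 1 < ‖x‖` and a unit `u`: `‖u⁻²(x − r)‖ = ‖x‖ > 1` (the image of a point of `E₁` under
an integral change of variables lies in `E_{q,1}`). [folklore] [cite: SilvermanAEC2009, III.1 Table 3.1] -/
theorem one_lt_norm_toX' {C : VariableChange K} (hu : ‖(C.u : K)‖ = 1)
    (hr : ‖C.r‖ ≤ 1) {x : K} (hx : 1 < ‖x‖) : 1 < ‖C.toX x‖ := by
  rw [VariableChange.toX_def, norm_mul, norm_pow, Units.val_inv_eq_inv_val, norm_inv, hu, inv_one,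
    one_pow, one_mul]
  have hne : ‖x‖ ≠ ‖-C.r‖ := by rw [norm_neg]; exact (hr.trans_lt hx).ne'
  rw [sub_eq_add_neg, IsUltrametricDist.norm_add_eq_max_of_norm_ne_norm hne]
  exact lt_max_of_lt_left hx


end Literature.NumberTheory.EllipticCurves.TateCurve

end
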